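import Mathlib.Analysis.SpecialFunctions.Pow.Real
import HarnessLib

/-!
# QUANT lane R8, T-DEC: the TWO-MID CELL of `LightSliceLowCrossBelow` — the PIECEWISE-LINEAR BRACKET LEMMAS (census-2 g60)

builds on p205010 (kernel theorem, internal audit signed; external expert review pending)

Support file (`--supports stmt-CriticalPhenomena-4575`), QUANT lane seat prim-quant-census-2 (gen 60), rung R8 of
`run/shared/lean/prim/quant/LADDER.md`.  Memo `run/shared/lean/prim/quant/prim-quant-census-2-g60/TWO-MID-G60.md` §3.  Pure real analysis;
theorems only, standard axioms, no sorries, no definitions.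

In the normalised dual of the two-mid price criterion (`…QuantTwoMidTerms`) each low `q` carries the price `α_q = min(1, U_{qh}β_h)` against a
mid `h` of price `β_h ≥ 0`; the dual inequality of the light-slice cell splits into two BRACKETS, each a convex piecewise-linear function of one
price whose breakpoints are `0`, `1/U_P` and `1/U_M` (`U_M ≤ U_P`, `U_M ≤` the capacity rate):
* **`b2_lower`** — `ℓ ≤ (1−γ)(βc₂ − α_P) + γ(1 − α_M)` for every `β ≥ 0`, given `ℓ ≤ γ` (resp. `ℓ ≤ 2γ − 1` if `P` is incompatible),
  `ℓ·U_P ≤ (1−γ)(c₂ − U_P) + γ(U_P − U_M)` and `ℓ·U_M ≤ (1−γ)(c₂ − U_M)` — the values at the three breakpoints;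
* **`b1_lower`** — `−L ≤ mE·((1−γ)(βc₁ − α_P) + γ(1 − α_M))` for every `β ≥ 0`, given `mE(1−2γ) ≤ L` when `P` is incompatible and
  `mE·((1−γ)(U_P − c₁) − γ(U_P − U_M)) ≤ L·U_P` (the value `w` at `β = 1/U_P`) when it is compatible;
* **`b1_lower_of_cap`** — the same conclusion from `mE(1−2γ) ≤ L` alone (using only `α_P ≤ 1`).
Used by `…QuantTwoMidCellReal` (`TwoMidCell.main`).

[this work].  The gluing rows served [cite: KozmaNitzan2024, Conjecture 3 (p. 15)]; product measure [cite: Grimmett1999, §1.3 p. 10].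
-/

noncomputable section

namespace Summit.CriticalPhenomena.PercolationContinuityZ3.Theorems

namespace Quant

namespace LawDec

namespace TwoMidCell

/-- **bracket 2 (the `P2`/`M2` pair priced against the head mid `H`) is at least `ℓ` for every price `β ≥ 0`**, given the three breakpoint
inequalities (`ℓ ≤ γ` resp. `ℓ ≤ 2γ − 1` at `β = 0`, `ℓ ≤ v₁` at `β = 1/U_P`, `ℓ ≤ v₂` at `β = 1/U_M`). [this work] -/
theorem b2_lower (γ c₂ UP UM ℓ β : ℝ) (cP : Prop) [Decidable cP] (hγ1 : γ ≤ 1) (hβ : 0 ≤ β)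
    (hUM0 : 0 < UM) (hUMc : UM ≤ c₂) (hUP : cP → 0 < UP ∧ UM ≤ UP)
    (hℓ0 : cP → ℓ ≤ γ) (hℓ0' : ¬ cP → ℓ ≤ 2 * γ - 1)
    (hℓ1 : cP → ℓ * UP ≤ (1 - γ) * (c₂ - UP) + γ * (UP - UM)) (hℓ2 : ℓ * UM ≤ (1 - γ) * (c₂ - UM)) :
    ℓ ≤ (1 - γ) * (β * c₂ - (if cP then min 1 (UP * β) else 1)) + γ * (1 - min 1 (UM * β)) := by
  have hc₂ : 0 ≤ c₂ := hUM0.le.trans hUMc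
  have hv2 : ℓ ≤ (1 - γ) * (c₂ / UM - 1) := by
    rw [← mul_le_mul_iff_left₀ hUM0]
    have : (1 - γ) * (c₂ / UM - 1) * UM = (1 - γ) * (c₂ - UM) := by field_simp
    rw [this]; exact hℓ2
  -- the region `UM β ≥ 1`: only the `c₂ β` term remains and it is past `v₂`
  have htop : 1 ≤ UM * β → ℓ ≤ (1 - γ) * (β * c₂ - 1) := by
    intro h1
    have hβ' : 1 / UM ≤ β := by rw [div_le_iff₀ hUM0]; linarith
    have : c₂ / UM ≤ β * c₂ := by
      rw [div_eq_mul_one_div, mul_comm]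
      exact mul_le_mul_of_nonneg_right hβ' hc₂
    nlinarith
  by_cases hcP : cP
  · obtain ⟨hUP0, hUMP⟩ := hUP hcP
    rw [if_pos hcP]
    have h0 := hℓ0 hcP
    have h1 := hℓ1 hcP
    rcases le_total (UP * β) 1 with hP1 | hP1
    · -- region `β ≤ 1/UP`: both mins are linear
      have hM1 : UM * β ≤ 1 := le_trans (mul_le_mul_of_nonneg_right hUMP hβ) hP1
      rw [min_eq_right hP1, min_eq_right hM1]
      -- convex combination of the values at `β = 0` and `β = 1/UP`
      have key : (1 - γ) * (β * c₂ - UP * β) + γ * (1 - UM * β) - ℓ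
          = (1 - UP * β) * (γ - ℓ) + β * ((1 - γ) * (c₂ - UP) + γ * (UP - UM) - ℓ * UP) := by ring
      nlinarith [mul_nonneg (sub_nonneg.2 hP1) (sub_nonneg.2 h0), mul_nonneg hβ (sub_nonneg.2 h1)]
    · rw [min_eq_left hP1]
      rcases le_total (UM * β) 1 with hM1 | hM1
      · rw [min_eq_right hM1]
        -- linear on `[1/UP, 1/UM]`: compare with the better endpoint according to the slope sign
        have hβlo : 1 / UP ≤ β := by rw [div_le_iff₀ hUP0]; linarith
        have hβhi : β ≤ 1 / UM := by rw [le_div_iff₀ hUM0]; linarith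
        have hv1 : ℓ ≤ (1 - γ) * (c₂ / UP - 1) + γ * (1 - UM / UP) := by
          rw [← mul_le_mul_iff_left₀ hUP0]
          have : ((1 - γ) * (c₂ / UP - 1) + γ * (1 - UM / UP)) * UP = (1 - γ) * (c₂ - UP) + γ * (UP - UM) := by
            field_simp
          rw [this]; exact h1
        rcases le_total 0 ((1 - γ) * c₂ - γ * UM) with hA | hA
        · -- nondecreasing: value at `1/UP`
          have : (1 - γ) * (c₂ / UP - 1) + γ * (1 - UM / UP) ≤ (1 - γ) * (β * c₂ - 1) + γ * (1 - UM * β) := by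
            have e : (1 - γ) * (β * c₂ - 1) + γ * (1 - UM * β) - ((1 - γ) * (c₂ / UP - 1) + γ * (1 - UM / UP))
                = ((1 - γ) * c₂ - γ * UM) * (β - 1 / UP) := by ring
            nlinarith [mul_nonneg hA (sub_nonneg.2 hβlo)]
          linarith
        · -- nonincreasing: value at `1/UM`
          have : (1 - γ) * (c₂ / UM - 1) ≤ (1 - γ) * (β * c₂ - 1) + γ * (1 - UM * β) := by
            have e : (1 - γ) * (β * c₂ - 1) + γ * (1 - UM * β) - (1 - γ) * (c₂ / UM - 1)
                = ((1 - γ) * c₂ - γ * UM) * (β - 1 / UM) + γ * (1 - UM * (1 / UM)) := by ring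
            have hz : UM * (1 / UM) = 1 := by field_simp
            rw [hz] at e
            nlinarith [mul_nonneg_of_nonpos_of_nonpos hA (sub_nonpos.2 hβhi)]
          linarith
      · rw [min_eq_left hM1]
        linarith [htop hM1]
  · rw [if_neg hcP]
    have h0 := hℓ0' hcP
    rcases le_total (UM * β) 1 with hM1 | hM1
    · rw [min_eq_right hM1]
      have hβhi : β ≤ 1 / UM := by rw [le_div_iff₀ hUM0]; linarith
      rcases le_total 0 ((1 - γ) * c₂ - γ * UM) with hA | hA
      · -- nondecreasing from `β = 0`
        nlinarith [mul_nonneg hA hβ]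
      · have e : (1 - γ) * (β * c₂ - 1) + γ * (1 - UM * β) - (1 - γ) * (c₂ / UM - 1)
            = ((1 - γ) * c₂ - γ * UM) * (β - 1 / UM) + γ * (1 - UM * (1 / UM)) := by ring
        have hz : UM * (1 / UM) = 1 := by field_simp
        rw [hz] at e
        nlinarith [mul_nonneg_of_nonpos_of_nonpos hA (sub_nonpos.2 hβhi)]
    · rw [min_eq_left hM1]
      linarith [htop hM1]


/-- **bracket 1 (the `P1`/`M1` pair priced against the second mid `Gm`, scaled by the expensive low mass `mE`) is at least `−L` for every
price `β ≥ 0`**, given the two breakpoint inequalities (`mE(1 − 2γ) ≤ L` when `P1` is incompatible; `mE·(−w)·U_P ≤ L·U_P` when it is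
compatible). [this work] -/
theorem b1_lower (γ c₁ UP UM mE L β : ℝ) (cP : Prop) [Decidable cP] (hγ0 : 0 ≤ γ) (hγ1 : γ ≤ 1) (hβ : 0 ≤ β) (hmE : 0 ≤ mE)
    (hL : 0 ≤ L) (hUM0 : 0 < UM) (hUMc : UM ≤ c₁) (hUP : cP → 0 < UP ∧ UM ≤ UP)
    (h1b : ¬ cP → mE * (1 - 2 * γ) ≤ L)
    (h1a : cP → mE * ((1 - γ) * (UP - c₁) - γ * (UP - UM)) ≤ L * UP) :
    -L ≤ mE * ((1 - γ) * (β * c₁ - (if cP then min 1 (UP * β) else 1)) + γ * (1 - min 1 (UM * β))) := by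
  -- the region `UM β ≥ 1`: bracket 1 is nonnegative there
  have htop : 1 ≤ UM * β → 0 ≤ (1 - γ) * (β * c₁ - 1) := by
    intro h1
    have hβ' : 1 / UM ≤ β := by rw [div_le_iff₀ hUM0]; linarith
    have : 1 ≤ β * c₁ := by
      have : 1 / UM * UM ≤ β * c₁ := mul_le_mul hβ' hUMc hUM0.le hβ
      rwa [div_mul_cancel₀ _ hUM0.ne'] at this
    exact mul_nonneg (by linarith) (by linarith)
  -- the value at `β = 1/UM` is nonnegative
  have hmid : 0 ≤ (1 - γ) * (c₁ / UM - 1) := mul_nonneg (by linarith) (by rw [sub_nonneg, le_div_iff₀ hUM0]; linarith)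
  by_cases hcP : cP
  · obtain ⟨hUP0, hUMP⟩ := hUP hcP
    rw [if_pos hcP]
    have h1 := h1a hcP
    rcases le_total (UP * β) 1 with hP1 | hP1
    · have hM1 : UM * β ≤ 1 := le_trans (mul_le_mul_of_nonneg_right hUMP hβ) hP1
      rw [min_eq_right hP1, min_eq_right hM1]
      have key : mE * ((1 - γ) * (β * c₁ - UP * β) + γ * (1 - UM * β)) + L
          = (1 - UP * β) * (mE * γ + L) + β * (L * UP - mE * ((1 - γ) * (UP - c₁) - γ * (UP - UM))) := by ring
      nlinarith [mul_nonneg (sub_nonneg.2 hP1) (add_nonneg (mul_nonneg hmE hγ0) hL), mul_nonneg hβ (sub_nonneg.2 h1)]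
    · rw [min_eq_left hP1]
      rcases le_total (UM * β) 1 with hM1 | hM1
      · rw [min_eq_right hM1]
        have hβlo : 1 / UP ≤ β := by rw [div_le_iff₀ hUP0]; linarith
        have hβhi : β ≤ 1 / UM := by rw [le_div_iff₀ hUM0]; linarith
        -- value at `1/UP` is `w`, with `mE w ≥ -L`
        have hw : -L ≤ mE * ((1 - γ) * (1 / UP * c₁ - 1) + γ * (1 - UM * (1 / UP))) := by
          have e : mE * ((1 - γ) * (1 / UP * c₁ - 1) + γ * (1 - UM * (1 / UP))) * UP
              = -(mE * ((1 - γ) * (UP - c₁) - γ * (UP - UM))) := by field_simp; ring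
          have : -L * UP ≤ mE * ((1 - γ) * (1 / UP * c₁ - 1) + γ * (1 - UM * (1 / UP))) * UP := by rw [e]; linarith
          exact le_of_mul_le_mul_right this hUP0
        rcases le_total 0 ((1 - γ) * c₁ - γ * UM) with hA | hA
        · have e : mE * ((1 - γ) * (β * c₁ - 1) + γ * (1 - UM * β)) - mE * ((1 - γ) * (1 / UP * c₁ - 1) + γ * (1 - UM * (1 / UP)))
              = mE * (((1 - γ) * c₁ - γ * UM) * (β - 1 / UP)) := by ring
          nlinarith [mul_nonneg hmE (mul_nonneg hA (sub_nonneg.2 hβlo))]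
        · have e : mE * ((1 - γ) * (β * c₁ - 1) + γ * (1 - UM * β)) - mE * ((1 - γ) * (c₁ / UM - 1))
              = mE * (((1 - γ) * c₁ - γ * UM) * (β - 1 / UM) + γ * (1 - UM * (1 / UM))) := by ring
          have hz : UM * (1 / UM) = 1 := by field_simp
          rw [hz] at e
          nlinarith [mul_nonneg hmE (mul_nonneg_of_nonpos_of_nonpos hA (sub_nonpos.2 hβhi)), mul_nonneg hmE hmid]
      · rw [min_eq_left hM1]
        nlinarith [mul_nonneg hmE (htop hM1)]
  · rw [if_neg hcP]
    have h0 := h1b hcP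
    rcases le_total (UM * β) 1 with hM1 | hM1
    · rw [min_eq_right hM1]
      have hβhi : β ≤ 1 / UM := by rw [le_div_iff₀ hUM0]; linarith
      rcases le_total 0 ((1 - γ) * c₁ - γ * UM) with hA | hA
      · -- nondecreasing from `β = 0`, where the value is `2γ - 1`
        have e : mE * ((1 - γ) * (β * c₁ - 1) + γ * (1 - UM * β)) = mE * (((1 - γ) * c₁ - γ * UM) * β) - mE * (1 - 2 * γ) := by ring
        nlinarith [mul_nonneg hmE (mul_nonneg hA hβ)]
      · have e : mE * ((1 - γ) * (β * c₁ - 1) + γ * (1 - UM * β)) - mE * ((1 - γ) * (c₁ / UM - 1))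
            = mE * (((1 - γ) * c₁ - γ * UM) * (β - 1 / UM) + γ * (1 - UM * (1 / UM))) := by ring
        have hz : UM * (1 / UM) = 1 := by field_simp
        rw [hz] at e
        nlinarith [mul_nonneg hmE (mul_nonneg_of_nonpos_of_nonpos hA (sub_nonpos.2 hβhi)), mul_nonneg hmE hmid]
    · rw [min_eq_left hM1]
      nlinarith [mul_nonneg hmE (htop hM1)]




/-- **bracket 1 via the cap `α_{P1} ≤ 1` only**: if `mE(1 − 2γ) ≤ L` then bracket 1 is at least `−L` for every price, whatever the
compatibility of `P1` (used when `P1` is incompatible or nearly so). [this work] -/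
theorem b1_lower_of_cap (γ c₁ UP UM mE L β : ℝ) (cP : Prop) [Decidable cP] (hγ1 : γ ≤ 1) (hβ : 0 ≤ β) (hmE : 0 ≤ mE)
    (hL : 0 ≤ L) (hUM0 : 0 < UM) (hUMc : UM ≤ c₁) (h1 : mE * (1 - 2 * γ) ≤ L) :
    -L ≤ mE * ((1 - γ) * (β * c₁ - (if cP then min 1 (UP * β) else 1)) + γ * (1 - min 1 (UM * β))) := by
  have hA : (if cP then min 1 (UP * β) else 1) ≤ (1 : ℝ) := by
    split_ifs
    · exact min_le_left _ _
    · exact le_rfl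
  have hmid : 0 ≤ (1 - γ) * (c₁ / UM - 1) := mul_nonneg (by linarith) (by rw [sub_nonneg, le_div_iff₀ hUM0]; linarith)
  -- reduce to the capped bracket `(1−γ)(βc₁ − 1) + γ(1 − min 1 (UM β))`
  have hred : mE * ((1 - γ) * (β * c₁ - 1) + γ * (1 - min 1 (UM * β)))
      ≤ mE * ((1 - γ) * (β * c₁ - (if cP then min 1 (UP * β) else 1)) + γ * (1 - min 1 (UM * β))) := by
    apply mul_le_mul_of_nonneg_left _ hmE
    nlinarith [mul_le_mul_of_nonneg_left hA (by linarith : (0:ℝ) ≤ 1 - γ)]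
  refine le_trans ?_ hred
  rcases le_total (UM * β) 1 with hM1 | hM1
  · rw [min_eq_right hM1]
    have hβhi : β ≤ 1 / UM := by rw [le_div_iff₀ hUM0]; linarith
    rcases le_total 0 ((1 - γ) * c₁ - γ * UM) with hA' | hA'
    · have e : mE * ((1 - γ) * (β * c₁ - 1) + γ * (1 - UM * β)) = mE * (((1 - γ) * c₁ - γ * UM) * β) - mE * (1 - 2 * γ) := by ring
      nlinarith [mul_nonneg hmE (mul_nonneg hA' hβ)]
    · have e : mE * ((1 - γ) * (β * c₁ - 1) + γ * (1 - UM * β)) - mE * ((1 - γ) * (c₁ / UM - 1))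
          = mE * (((1 - γ) * c₁ - γ * UM) * (β - 1 / UM) + γ * (1 - UM * (1 / UM))) := by ring
      have hz : UM * (1 / UM) = 1 := by field_simp
      rw [hz] at e
      nlinarith [mul_nonneg hmE (mul_nonneg_of_nonpos_of_nonpos hA' (sub_nonpos.2 hβhi)), mul_nonneg hmE hmid]
  · rw [min_eq_left hM1]
    have hβ' : 1 / UM ≤ β := by rw [div_le_iff₀ hUM0]; linarith
    have : 1 ≤ β * c₁ := by
      have : 1 / UM * UM ≤ β * c₁ := mul_le_mul hβ' hUMc hUM0.le hβ
      rwa [div_mul_cancel₀ _ hUM0.ne'] at this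
    have h0 : 0 ≤ (1 - γ) * (β * c₁ - 1) := mul_nonneg (by linarith) (by linarith)
    nlinarith [mul_nonneg hmE h0]


end TwoMidCell

end LawDec

end Quant

end Summit.CriticalPhenomena.PercolationContinuityZ3.Theorems
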